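import Summits.QuantumAdvantage.QuantumAdvantage.Theses.CubicForrelation
import Literature.Computability.QuantumComplexity.ForrelationDerivativeTables

/-!
# Sketch — crux-ideate 3 (round 1) on `SignedCubicForrelationNotPrBPP` (stmt-QuantumAdvantage-13931)

First lemmas of the idea card `light-tail-keyless-band` (signatures that elaborate over existing
declarations; the glue lemmas are PROVED, the two load-bearing statements are stated as `Prop`s):

* `promiseBPP'_antitone`, `restrictedSigned`, `crux_of_restricted` — sub-promise transfer for the WHOLE
  signed problem (band included): hardness of ANY sub-family implies the crux `X`.
* `IsBentWithDual`, `hdist`, `DualDistanceIdentity` — the LEVER: for bent `b` with dual `d`,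
  `Φ(a,b) = 1 − 2·dist(a,d)/2ⁿ` for EVERY `a`; so the band tolerates `2ⁿ/5` of dual damage and the second
  function's dual need NOT be cubic.
* `dualOf`, `IsWindow`, `HasWindow`, `IsLightTailKeyless`, `LightTailKeylessHard`, `crux_of_lightTail`
  (PROVED transfer) and the existence stub `LightTailDeepNonempty` (OPEN; the kit jobs j013211/j013224
  settle its `n = 10`, corank-0 shadow).
* Card `kernel-descent`: `kernelForm`, `quarterOf`, `QuarterIdentity` (stated; numerically verified in these
  conventions by quartercheck.py), `QuarterSignRule` (PROVED, `quarterSignRule`), `HasKernelDirection`,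
  `KernelFreeHard`, `crux_of_kernelFree` (PROVED transfer).
-/

set_option linter.dupNamespace false

noncomputable section

open Literature.Computability.QuantumComplexity Literature.Computability.Complexity
open Literature.Computability.QuantumComplexity.BuzetChailloux (bxor zeroVec)
open Literature.Computability.QuantumComplexity.DerivativeWalsh (W)

namespace Summit.QuantumAdvantage.QuantumAdvantage.Cruxes.SignedCubicForrelationNotPrBPP.Ideator3

/-! ### Sub-promise transfer for the signed problem -/

/-- `PromiseBPP'` is antitone in the promise. [cite: Goldreich2006, §1.1] -/
theorem promiseBPP'_antitone {Q Q' : PromiseProblem} (hy : Q'.yes ≤ Q.yes) (hn : Q'.no ≤ Q.no)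
    (h : Q ∈ PromiseBPP') : Q' ∈ PromiseBPP' := by
  obtain ⟨L', hL', p, h1, h2⟩ := h
  exact ⟨L', hL', p, fun x hx => h1 x (hy hx), fun x hx => h2 x (hn hx)⟩

/-- Yes-side conditions of the crux's promise problem (literally those of `signedCubicForrelationProblem 2`). -/
def IsSignedYes (I : KForrelationInstance) : Prop :=
  I.IsYes ∧ I.k = 2 ∧ Even I.n ∧ ∀ i, IsDegLeFun 3 (I.C i).eval

/-- No-side conditions of the crux's promise problem. -/
def IsSignedNo (I : KForrelationInstance) : Prop :=
  (I.IsOverB2 ∧ I.value ≤ -(3 / 5 : ℝ)) ∧ I.k = 2 ∧ Even I.n ∧ ∀ i, IsDegLeFun 3 (I.C i).eval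

/-- The signed cubic 2-fold Forrelation problem restricted by an arbitrary side condition `P`. -/
def restrictedSigned (P : KForrelationInstance → Prop) : PromiseProblem :=
  ⟨KForrelationInstance.encode '' {I | IsSignedYes I ∧ P I},
   KForrelationInstance.encode '' {I | IsSignedNo I ∧ P I}⟩

/-- **Transfer glue (proved).** Hardness of any restricted family implies the crux `X`. -/
theorem crux_of_restricted (P : KForrelationInstance → Prop)
    (h : restrictedSigned P ∉ PromiseBPP') :
    Theses.CubicForrelation.SignedCubicForrelationNotPrBPP := by
  intro hmem
  apply h
  refine promiseBPP'_antitone ?_ ?_ hmem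
  · rintro _ ⟨I, ⟨hI, -⟩, rfl⟩
    exact ⟨I, hI, rfl⟩
  · rintro _ ⟨I, ⟨hI, -⟩, rfl⟩
    exact ⟨I, hI, rfl⟩

/-! ### The lever: dual-damage identity -/

variable {n : ℕ}

/-- `b` on `m + m` bits is bent with dual exactly `d`: `W_{(-1)^b}(u) = 2^m·(-1)^{d(u)}` for all `u`. -/
def IsBentWithDual (m : ℕ) (b d : (Fin (m + m) → Bool) → Bool) : Prop :=
  ∀ u, W (fun y => signOf (b y)) u = (2 : ℝ) ^ m * signOf (d u)

/-- Hamming distance of two Boolean functions. -/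
def hdist (f g : (Fin n → Bool) → Bool) : ℕ :=
  (Finset.univ.filter fun x => f x ≠ g x).card

/-- **LEVER (dual-damage identity; first lemma of the card — PROVED below as `dualDistanceIdentity`; two lines on paper:
`Φ(a,b) = 2^{-3n/2} Σ_x (-1)^{a(x)} W_b(x) = 2^{-n} Σ_x (-1)^{a(x)+d(x)}`).**  For a bent `b` with dual `d`
and EVERY Boolean `a`: `Φ(a,b) = 1 − 2·dist(a,d)/2ⁿ`.  Consequences: `(a,b)` is a YES instance of the signed
problem iff `dist(a,d) ≤ 2ⁿ/5`, a NO instance iff `dist(a,d) ≥ 4·2ⁿ/5`; the dual `d` itself need not be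
cubic. (Checked numerically on the PP20 functions by `lighttail.py`, kit j013211.) -/
def DualDistanceIdentity : Prop :=
  ∀ (m : ℕ) (a b d : (Fin (m + m) → Bool) → Bool), IsBentWithDual m b d →
    forrelation a b = 1 - 2 * (hdist a d : ℝ) / (2 : ℝ) ^ (m + m)

/-- The dual SIGN PATTERN of an arbitrary Boolean `b` (for bent `b` this is its dual function). -/
def dualOf (b : (Fin n → Bool) → Bool) : (Fin n → Bool) → Bool :=
  fun u => decide (W (fun y => signOf (b y)) u < 0)

/-! ### Windows (affine half-flats up to corank `t`) and MM subspaces -/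

/-- Second derivative `D_u D_v b (x)`. -/
def d2 (b : (Fin n → Bool) → Bool) (u v x : Fin n → Bool) : Bool :=
  (b x ^^ b (bxor x u)) ^^ (b (bxor x v) ^^ b (bxor (bxor x u) v))

/-- `s + U` is an affine WINDOW of corank `≤ t` for `b`: `U` xor-closed with `|U|²·4^t ≥ 2ⁿ`
(`dim U ≥ n/2 − t`) and `b` affine on the single coset `s + U`.  Corank `0` and "every coset" is an MM
subspace (Dillon); corank `0` and one coset is (weak) normality. -/
def IsWindow (b : (Fin n → Bool) → Bool) (t : ℕ) (U : Finset (Fin n → Bool)) (s : Fin n → Bool) : Prop :=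
  (∀ u ∈ U, ∀ v ∈ U, bxor u v ∈ U) ∧ 2 ^ n ≤ U.card * U.card * 4 ^ t ∧
    ∀ u ∈ U, ∀ v ∈ U, d2 b u v s = false

/-- `b` has some affine window of corank `≤ t`. By the window-sign-leak lever (r3 card) such a window,
once FOUND, decides the sign of an EXACT pair in `4^t·poly` samples. -/
def HasWindow (b : (Fin n → Bool) → Bool) (t : ℕ) : Prop :=
  ∃ U s, IsWindow b t U s

/-- `U` is an MM subspace of `b` (affine on ALL cosets, `|U|² ≥ 2ⁿ`). [cite: Carlet2020, §6.1] -/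
def IsMMSubspace (b : (Fin n → Bool) → Bool) (U : Finset (Fin n → Bool)) : Prop :=
  (∀ u ∈ U, ∀ v ∈ U, bxor u v ∈ U) ∧ 2 ^ n ≤ U.card * U.card ∧
    ∀ u ∈ U, ∀ v ∈ U, ∀ x, d2 b u v x = false

/-- `b` is completed-Maiorana–McFarland-SHAPED (has an MM subspace). -/
def HasMMSubspace (b : (Fin n → Bool) → Bool) : Prop :=
  ∃ U : Finset (Fin n → Bool), IsMMSubspace b U

/-! ### The light-tail keyless family and its transfer -/

/-- Instance-level side condition of the card (corank-0 form): the SECOND circuit computes a BENT function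
whose dual sign pattern is NOT cubic (so the pair is not a damaged copy of an exact cubic pair with the
same bent half), and NEITHER function is MM-shaped. (The promise `|Φ| ≥ 3/5` then forces, by the
dual-damage identity, `dist(a, b̃) ≤ 2ⁿ/5` or `≥ 4·2ⁿ/5`.) -/
def IsLightTailKeyless (I : KForrelationInstance) : Prop :=
  ∀ h : I.k = 2,
    (∀ u, W (fun y => signOf ((I.C (Fin.cast h.symm 1)).eval y)) u ^ 2 = (2 : ℝ) ^ I.n) ∧
    ¬ IsDegLeFun 3 (dualOf (I.C (Fin.cast h.symm 1)).eval) ∧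
    ¬ HasMMSubspace (I.C (Fin.cast h.symm 1)).eval ∧ ¬ HasMMSubspace (I.C (Fin.cast h.symm 0)).eval

/-- **The card's hypothesis `C⁺`:** signed cubic 2-fold Forrelation restricted to light-tail keyless
instances is not in `prBPP`. -/
def LightTailKeylessHard : Prop :=
  restrictedSigned IsLightTailKeyless ∉ PromiseBPP'

/-- **Transfer (proved):** `C⁺ → X`. -/
theorem crux_of_lightTail (h : LightTailKeylessHard) :
    Theses.CubicForrelation.SignedCubicForrelationNotPrBPP :=
  crux_of_restricted _ h

/-- **Load-bearing existence stub (OPEN; quantitative form of Polujan–Pott 2020 Open Problems 5.1/5.2).**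
For every corank `t`, for infinitely many even `n` there are cubic `a`, `b` on `n` bits with `b` bent,
dual sign pattern of `b` not cubic, `Φ(a,b) ≥ 3/5`, and NO affine window of corank `≤ t` on either side
("window corank → ∞").  At `t = 0`, `n = 10`: `b = h¹⁰₃` (PP20, outside MM#) with a cubic `a` at distance
`152/1024` from its quartic dual gives `Φ = 0.703` (kit j013211; `h¹⁰₃` is however NORMAL, so corank 0
windows exist there — the stub asks for growing corank). -/
def LightTailDeepNonempty : Prop :=
  ∀ t N : ℕ, ∃ n, N ≤ n ∧ Even n ∧ ∃ a b : (Fin n → Bool) → Bool,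
    IsDegLeFun 3 a ∧ IsDegLeFun 3 b ∧ (∀ u, W (fun y => signOf (b y)) u ^ 2 = (2 : ℝ) ^ n) ∧
    ¬ IsDegLeFun 3 (dualOf b) ∧ (3 / 5 : ℝ) ≤ forrelation a b ∧ ¬ HasWindow a t ∧ ¬ HasWindow b t

end Summit.QuantumAdvantage.QuantumAdvantage.Cruxes.SignedCubicForrelationNotPrBPP.Ideator3

end

/-! ### Proof of the lever -/

namespace Summit.QuantumAdvantage.QuantumAdvantage.Cruxes.SignedCubicForrelationNotPrBPP.Ideator3

open Literature.Computability.QuantumComplexity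
open Literature.Computability.QuantumComplexity.BuzetChailloux (phi phi_signOf)
open Literature.Computability.QuantumComplexity.DerivativeWalsh (fsum_eq_sum_mul_W phi_eq_fsum)

/-- `(-1)^p · (-1)^q = 1 - 2·[p ≠ q]`. -/
theorem signOf_mul_signOf_eq (p q : Bool) :
    signOf p * signOf q = 1 - 2 * (if p ≠ q then (1 : ℝ) else 0) := by
  cases p <;> cases q <;> simp [signOf] <;> norm_num

/-- **The dual-damage identity (PROVED):** for bent `b` with dual `d`, `Φ(a,b) = 1 − 2·dist(a,d)/2ⁿ`. -/
theorem dualDistanceIdentity : DualDistanceIdentity := by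
  intro m a b d hbd
  rw [← phi_signOf, phi_eq_fsum, fsum_eq_sum_mul_W]
  have hW : ∀ x, signOf (a x) * DerivativeWalsh.W (fun y => signOf (b y)) x
      = (2 : ℝ) ^ m * (1 - 2 * (if a x ≠ d x then (1 : ℝ) else 0)) := by
    intro x
    rw [hbd x, ← signOf_mul_signOf_eq]
    ring
  simp_rw [hW]
  rw [← Finset.mul_sum, Finset.sum_sub_distrib, ← Finset.mul_sum, Finset.sum_boole]
  have hcard : (∑ _x : Fin (m + m) → Bool, (1 : ℝ)) = (2 : ℝ) ^ (m + m) := by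
    simp [Finset.card_univ, Fintype.card_fun, Fintype.card_bool, Fintype.card_fin]
  rw [hcard]
  have hsqrt : Real.sqrt ((2 : ℝ) ^ (3 * (m + m))) = (2 : ℝ) ^ m * (2 : ℝ) ^ (m + m) := by
    have : (2 : ℝ) ^ (3 * (m + m)) = ((2 : ℝ) ^ m * (2 : ℝ) ^ (m + m)) ^ 2 := by
      rw [← pow_add, ← pow_mul]; congr 1; ring
    rw [this, Real.sqrt_sq (by positivity)]
  rw [hsqrt]
  unfold hdist
  have h2 : (2 : ℝ) ^ m ≠ 0 := pow_ne_zero _ two_ne_zero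
  have h4 : (2 : ℝ) ^ (m + m) ≠ 0 := pow_ne_zero _ two_ne_zero
  field_simp

end Summit.QuantumAdvantage.QuantumAdvantage.Cruxes.SignedCubicForrelationNotPrBPP.Ideator3

/-! ### Card `kernel-descent`: the quarter identity behind the affine-derivative reduction -/

namespace Summit.QuantumAdvantage.QuantumAdvantage.Cruxes.SignedCubicForrelationNotPrBPP.Ideator3

open Literature.Computability.QuantumComplexity Literature.Computability.Complexity

variable {n : ℕ}

/-- The normal form forced by a kernel direction of the cubic tensor (`T(h,·,·) = 0`, i.e. `D_h b` affine,
`h ↦ e₀`, `D_h b ↦ x₁`): `b(x₀,x₁,x″) = x₁·(x₀ ⊕ B₁(x″)) ⊕ B₀(x″)` on `n + 2` bits. -/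
def kernelForm (B₀ B₁ : (Fin n → Bool) → Bool) : (Fin (n + 2) → Bool) → Bool :=
  fun x => (x 1 && (x 0 ^^ B₁ (Fin.tail (Fin.tail x)))) ^^ B₀ (Fin.tail (Fin.tail x))

/-- The `(q₀,q₁)`-quarter of a function on `n + 2` bits: fix the two leading coordinates. -/
def quarterOf (a : (Fin (n + 2) → Bool) → Bool) (q₀ q₁ : Bool) : (Fin n → Bool) → Bool :=
  fun u => a (Fin.cons q₀ (Fin.cons q₁ u))

/-- **QUARTER IDENTITY (first lemma of card `kernel-descent`; exact, no bentness, no degree hypothesis):**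
`Φ(a, x₁(x₀ ⊕ B₁) ⊕ B₀) = ¼ Σ_{q ∈ 𝔽₂²} Φ(a_q ⊕ q₀q₁, B₀ ⊕ q₀·B₁)` — because
`W_b(u₀,u₁,u″) = 2·(−1)^{u₀u₁}·W_{B₀ ⊕ u₀B₁}(u″)`.  Consequence: `|Φ(a,b)| ≥ 3/5` forces a quarter with
`|Φ_q| ≥ 3/5`, and `sgn Φ(a,b) = sgn Σ_{|Φ_q| ≥ 3/5} Φ_q` (the sub-threshold quarters cannot flip it), so a
kernel direction on either side reduces the signed instance on `n + 2` bits to ≤ 4 signed instances on `n` bits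
plus four classical `|Φ|`-estimates. -/
def QuarterIdentity : Prop :=
  ∀ (n : ℕ) (a : (Fin (n + 2) → Bool) → Bool) (B₀ B₁ : (Fin n → Bool) → Bool),
    forrelation a (kernelForm B₀ B₁) =
      (1 / 4 : ℝ) * ∑ q₀ : Bool, ∑ q₁ : Bool,
        forrelation (fun u => quarterOf a q₀ q₁ u ^^ (q₀ && q₁)) (fun u => B₀ u ^^ (q₀ && B₁ u))

/-- **Sign bookkeeping (elementary real inequality, the other half of the descent step):** if four reals in
`[-1,1]` average to `≥ 3/5` then the sum of those of absolute value `≥ 3/5` is positive (and symmetrically). -/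
def QuarterSignRule : Prop :=
  ∀ Φ : Bool → Bool → ℝ, (∀ q₀ q₁, |Φ q₀ q₁| ≤ 1) →
    (3 / 5 : ℝ) ≤ (1 / 4) * ∑ q₀, ∑ q₁, Φ q₀ q₁ →
      0 < ∑ q₀, ∑ q₁, (if (3 / 5 : ℝ) ≤ |Φ q₀ q₁| then Φ q₀ q₁ else 0)

/-- **Terminality (consequence for the X side, condition (H4) of card `light-tail-keyless-band`):** the signed
problem restricted to instances BOTH of whose cubic tensors have trivial kernel (no affine derivative on either
side).  `d3Kernel f h := ∀ v w x, D_h D_v D_w f x = 0`. -/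
def d3 (f : (Fin n → Bool) → Bool) (u v w x : Fin n → Bool) : Bool :=
  d2 f u v x ^^ d2 f u v (Literature.Computability.QuantumComplexity.BuzetChailloux.bxor x w)

/-- `f` has a kernel direction (an affine derivative): some `h ≠ 0` with `T_f(h,·,·) ≡ 0`. -/
def HasKernelDirection (f : (Fin n → Bool) → Bool) : Prop :=
  ∃ h, h ≠ Literature.Computability.QuantumComplexity.BuzetChailloux.zeroVec ∧ ∀ v w x, d3 f h v w x = false

/-- The kernel-free (terminal) sub-family of the signed problem. By the descent, X can only be carried here:
`X → KernelFreeHard` is the content of the card (modulo the threshold bookkeeping), `KernelFreeHard → X` is the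
proved glue `crux_of_restricted`. -/
def KernelFreeHard : Prop :=
  restrictedSigned (fun I => ∀ h : I.k = 2,
      ¬ HasKernelDirection (I.C (Fin.cast h.symm 0)).eval ∧ ¬ HasKernelDirection (I.C (Fin.cast h.symm 1)).eval)
    ∉ PromiseBPP'

theorem crux_of_kernelFree (h : KernelFreeHard) :
    Theses.CubicForrelation.SignedCubicForrelationNotPrBPP :=
  crux_of_restricted _ h

end Summit.QuantumAdvantage.QuantumAdvantage.Cruxes.SignedCubicForrelationNotPrBPP.Ideator3

namespace Summit.QuantumAdvantage.QuantumAdvantage.Cruxes.SignedCubicForrelationNotPrBPP.Ideator3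

/-- **QuarterSignRule (PROVED):** pointwise `Φ_q − 3/5 < [big]·Φ_q`, summed over the four quarters. -/
theorem quarterSignRule : QuarterSignRule := by
  intro Φ hb havg
  have pt : ∀ q₀ q₁, Φ q₀ q₁ - 3 / 5 < (if (3 / 5 : ℝ) ≤ |Φ q₀ q₁| then Φ q₀ q₁ else 0) := by
    intro q₀ q₁
    split_ifs with h
    · linarith
    · have := (abs_lt.mp (not_le.mp h)).2
      linarith
  simp only [Fintype.sum_bool] at havg ⊢
  have h1 := pt true true
  have h2 := pt true false
  have h3 := pt false true
  have h4 := pt false false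
  linarith

end Summit.QuantumAdvantage.QuantumAdvantage.Cruxes.SignedCubicForrelationNotPrBPP.Ideator3
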